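import Literature.Combinatorics.SimpleGraph.ReducedDivisors
import HarnessLib

/-!
# Dhar's burning algorithm as a computation: the burnt sets `B₀ = {q} ⊆ B₁ ⊆ ⋯` and
# «`D` is `q`-reduced iff the fire eventually burns through every vertex» (Baker–Shokrieh 2013, §5.1)

Source (held, read at the page; statements VERBATIM). M. Baker, F. Shokrieh, *Chip-firing games,
potential theory on graphs, and spanning trees*, J. Combin. Theory Ser. A 120 (2013) 164–182
[BakerShokrieh2013] (held text `paper:arxiv-1107.1313`, chunk p0011), §5.1 «Dhar's algorithm»:
«there is in fact a much more efficient procedure called Dhar's burning algorithm (after Dhar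
[Dhar90]). […] A fire starts at vertex `q` and proceeds along each edge adjacent to `q`. At each
vertex `v ≠ q`, there are `D(v)` firefighters, each of whom can control fires in a single
direction (i.e., edge) leading into `v`. Whenever there are fires approaching `v` in more than
`D(v)` directions, the fire burns through `v` and proceeds to burn along all the other edges
incident to `v`. The divisor `D` is `q`-reduced iff the fire eventually burns through every vertex
of `G`.» (The tree's `ReducedDivisorsDhar.isReduced_iff_exists_burningOrder` is the same
criterion phrased with a burning ORDER; here the burning PROCESS itself is defined, so that the
test is a finite computation.)

## What is formalised (vocabulary: `IsReduced G q D` of `ReducedDivisors`)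

* `burnStep G q D B` (one round of the fire: add every `v ≠ q` with more burning neighbours
  than firefighters, `D(v) < |N(v) ∩ B|`), `burnt G q D k` (the burnt set after `k` rounds,
  `burnt 0 = {q}`); monotonicity `burnt_mono`, stabilisation after `|V|` rounds
  `burnt_card_succ_eq`;
* **`isReduced_iff_burnt_eq_univ`** — «`D` is `q`-reduced iff the fire eventually burns through
  every vertex»: `IsReduced G q D ↔ (D ≥ 0 off q) ∧ burnt G q D |V| = V`.

Two definitions (`burnStep`, `burnt`) with bodies, theorems otherwise; no `sorry`; no named facts.
-/

open Finset SimpleGraph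

namespace Literature.Combinatorics.SimpleGraph.BakerNorine

variable {V : Type*} [Fintype V] [DecidableEq V] (G : SimpleGraph V) [DecidableRel G.Adj]

/-! ### §1 The burning process -/

section Process

/-- One round of Dhar's fire: «Whenever there are fires approaching `v` in more than `D(v)`
directions, the fire burns through `v`» — add to the burnt set `B` every `v ≠ q` with
`D(v) < |N(v) ∩ B|`. [cite: BakerShokrieh2013, §5.1] -/
def burnStep (q : V) (D : V → ℤ) (B : Finset V) : Finset V :=
  B ∪ univ.filter fun v => v ≠ q ∧ D v < #(G.neighborFinset v ∩ B)

/-- The burnt set after `k` rounds: «A fire starts at vertex `q`» (`burnt 0 = {q}`), then round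
after round. [cite: BakerShokrieh2013, §5.1] -/
def burnt (q : V) (D : V → ℤ) : ℕ → Finset V
  | 0 => {q}
  | k + 1 => burnStep G q D (burnt q D k)

variable {G}

/-- Unfolding one round. [cite: BakerShokrieh2013, §5.1] -/
theorem mem_burnStep {q : V} {D : V → ℤ} {B : Finset V} {v : V} :
    v ∈ burnStep G q D B ↔ v ∈ B ∨ (v ≠ q ∧ D v < #(G.neighborFinset v ∩ B)) := by
  rw [burnStep, mem_union, mem_filter]
  simp only [mem_univ, true_and]

/-- `burnt 0 = {q}`. [cite: BakerShokrieh2013, §5.1] -/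
theorem burnt_zero (q : V) (D : V → ℤ) : burnt G q D 0 = {q} := rfl

/-- `burnt (k+1) = burnStep (burnt k)`. [cite: BakerShokrieh2013, §5.1] -/
theorem burnt_succ (q : V) (D : V → ℤ) (k : ℕ) :
    burnt G q D (k + 1) = burnStep G q D (burnt G q D k) := rfl

/-- The fire only spreads: `B ⊆ burnStep B`. [cite: BakerShokrieh2013, §5.1] -/
theorem subset_burnStep (q : V) (D : V → ℤ) (B : Finset V) : B ⊆ burnStep G q D B :=
  fun _ hv => mem_burnStep.2 (Or.inl hv)

/-- `burnt k ⊆ burnt (k + 1)`. [cite: BakerShokrieh2013, §5.1] -/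
theorem burnt_mono (q : V) (D : V → ℤ) (k : ℕ) : burnt G q D k ⊆ burnt G q D (k + 1) :=
  subset_burnStep q D _

/-- `burnt k ⊆ burnt l` for `k ≤ l`. [cite: BakerShokrieh2013, §5.1] -/
theorem burnt_subset_of_le (q : V) (D : V → ℤ) {k l : ℕ} (h : k ≤ l) :
    burnt G q D k ⊆ burnt G q D l := by
  induction l, h using Nat.le_induction with
  | base => exact Subset.rfl
  | succ l _ ih => exact ih.trans (burnt_mono q D l)

/-- `q` is burnt from the start. [cite: BakerShokrieh2013, §5.1] -/
theorem base_mem_burnt (q : V) (D : V → ℤ) (k : ℕ) : q ∈ burnt G q D k :=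
  burnt_subset_of_le q D (Nat.zero_le k) (by rw [burnt_zero]; exact mem_singleton_self q)

/-- Once a round burns nothing new, the process is stationary.
[cite: BakerShokrieh2013, §5.1] -/
theorem burnt_add_eq_of_eq (q : V) (D : V → ℤ) {k : ℕ} (h : burnt G q D (k + 1) = burnt G q D k)
    (j : ℕ) : burnt G q D (k + j) = burnt G q D k := by
  induction j with
  | zero => rfl
  | succ j ih => rw [← add_assoc, burnt_succ, ih, ← burnt_succ, h]

/-- **Termination**: after `|V|` rounds the fire has stopped spreading.
[cite: BakerShokrieh2013, §5.1 («For `1 ≤ i ≤ n − 1` …»)] -/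
theorem burnt_card_succ_eq (q : V) (D : V → ℤ) :
    burnt G q D (Fintype.card V + 1) = burnt G q D (Fintype.card V) := by
  -- otherwise the burnt sets grow strictly for `|V| + 1` rounds, exceeding `|V|` vertices
  by_contra hne
  have hstrict : ∀ k, k ≤ Fintype.card V → burnt G q D (k + 1) ≠ burnt G q D k := by
    intro k hk heq
    exact hne (by
      have := burnt_add_eq_of_eq q D heq (Fintype.card V - k)
      have h2 := burnt_add_eq_of_eq q D heq (Fintype.card V + 1 - k)
      rw [show k + (Fintype.card V + 1 - k) = Fintype.card V + 1 by omega] at h2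
      rw [show k + (Fintype.card V - k) = Fintype.card V by omega] at this
      rw [h2, this])
  have hcard : ∀ k, k ≤ Fintype.card V + 1 → k + 1 ≤ #(burnt G q D k) := by
    intro k
    induction k with
    | zero => intro; rw [burnt_zero, card_singleton]
    | succ k ih =>
      intro hk
      have h1 := ih (by omega)
      have hss : burnt G q D k ⊂ burnt G q D (k + 1) :=
        (burnt_mono q D k).ssubset_of_ne (hstrict k (by omega)).symm
      have := card_lt_card hss
      omega
  have h := hcard (Fintype.card V) (by omega)
  have h' := card_le_univ (burnt G q D (Fintype.card V))
  omega

end Process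

/-! ### §2 Correctness: «`D` is `q`-reduced iff the fire eventually burns through every vertex» -/

section Correct

variable {G}

/-- **Dhar's burning algorithm is correct.** «The divisor `D` is `q`-reduced iff the fire
eventually burns through every vertex of `G`» (together with the preliminary test «If
`D(v) < 0` for some `v ∈ V(G)∖{q}` output FALSE»). [cite: BakerShokrieh2013, §5.1] -/
theorem isReduced_iff_burnt_eq_univ (q : V) (D : V → ℤ) :
    IsReduced G q D ↔ (∀ v, v ≠ q → 0 ≤ D v) ∧ burnt G q D (Fintype.card V) = univ := by
  constructor
  · intro hD
    refine ⟨fun v hv => hD.nonneg hv, ?_⟩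
    -- if some vertices never burn, they form a set `A ∌ q` violating reducedness
    by_contra hne
    set B := burnt G q D (Fintype.card V) with hB
    have hA : (univ \ B).Nonempty := by
      rw [nonempty_iff_ne_empty, Ne, sdiff_eq_empty_iff_subset]
      exact fun h => hne (Subset.antisymm (subset_univ _) h)
    have hqA : q ∉ univ \ B := fun h => (mem_sdiff.1 h).2 (base_mem_burnt q D _)
    obtain ⟨v, hvA, hlt⟩ := hD.2 (univ \ B) hA hqA
    have hvB : v ∉ B := (mem_sdiff.1 hvA).2
    have hvq : v ≠ q := fun h => hqA (h ▸ hvA)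
    -- `N(v) \ (V \ B) = N(v) ∩ B`, so `v` burns in the next round — which adds nothing
    have hset : G.neighborFinset v \ (univ \ B) = G.neighborFinset v ∩ B := by
      ext w; simp [mem_sdiff, mem_inter]
    rw [hset] at hlt
    have hv' : v ∈ burnt G q D (Fintype.card V + 1) := by
      rw [burnt_succ, mem_burnStep]
      exact Or.inr ⟨hvq, hlt⟩
    rw [burnt_card_succ_eq] at hv'
    exact hvB hv'
  · rintro ⟨h0, hall⟩
    refine ⟨h0, fun A hA hqA => ?_⟩
    classical
    -- the first round in which the fire reaches `A`
    have hex : ∃ k, (A ∩ burnt G q D k).Nonempty := by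
      obtain ⟨a, ha⟩ := hA
      exact ⟨Fintype.card V, a, mem_inter.2 ⟨ha, by rw [hall]; exact mem_univ a⟩⟩
    obtain ⟨v, hv⟩ := Nat.find_spec hex
    have hk0 : Nat.find hex ≠ 0 := by
      intro h0'
      have hv' := hv
      rw [h0', burnt_zero, mem_inter, mem_singleton] at hv'
      exact hqA (hv'.2 ▸ hv'.1)
    obtain ⟨k, hk⟩ := Nat.exists_eq_succ_of_ne_zero hk0
    have hmin : ¬ (A ∩ burnt G q D k).Nonempty := Nat.find_min hex (by omega)
    rw [hk, mem_inter, burnt_succ, mem_burnStep] at hv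
    obtain ⟨hvA, hv⟩ := hv
    have hvk : v ∉ burnt G q D k := fun h => hmin ⟨v, mem_inter.2 ⟨hvA, h⟩⟩
    rcases hv with h | ⟨-, hlt⟩
    · exact absurd h hvk
    · -- the burning neighbours of `v` lie outside `A` (nothing of `A` has burnt before round `k+1`)
      refine ⟨v, hvA, hlt.trans_le ?_⟩
      exact_mod_cast card_le_card fun w hw => mem_sdiff.2 ⟨(mem_inter.1 hw).1,
        fun hwA => hmin ⟨w, mem_inter.2 ⟨hwA, (mem_inter.1 hw).2⟩⟩⟩

end Correct

end Literature.Combinatorics.SimpleGraph.BakerNorine
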